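import Summits.QuantumFields.YangMills.Theorems.BalabanUVNodesN21ExpWindowHaarMassLtOne
import Summits.QuantumFields.BalabanUV.T4Continuum.Support.UnitaryResolventMargin

/-!
# N21 (NE7c) · THE EXPONENTIAL CHART OF `SU(N)` IS ONTO, WITH A HILBERT–SCHMIDT NORM BOUND: every `U ∈ SU(N)` is `expPtSU v` with
# `‖v‖_HS ≤ (N+1)·√N·π`; hence LARGE WINDOWS ARE THE WHOLE GROUP (`expBallSU S = SU(N)`, Haar mass `1`, for `S ≥ (N+1)·√N·π`) — the
# radius side of file 18's properness `Haar (expBallSU S) < 1` (`S ≤ π`, `N ≥ 2`) is tight up to the constant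

Width seat pub-ymgap-dag-n21-w1 (g3; director-ym №197 ∕ HUMAN RULING D-0149), node N21 = NE7c (NOT PRINTED in [Bałaban 1983–89], NOT
proved), lane K3⁷ `SpineGivenEndpointR13SepCoPH` (stmt-QuantumFields-20544, `--kind proof --supports … --as helper`).  File 19 of the
seat's chain.  THEOREMS ONLY: 0 `def`, 0 `sorry`; count-neutral.  Imports file 18 `…N21ExpWindowHaarMassLtOne` (`det_conjDiag`; brings
pub-balaban's chart modules `ShellMeasureExpChartSUN` ∕ `…VandermondeSUN` ∕ `…ExpJacobianSUN` ∕ `…ScalingSUN`) and pub-balaban's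
`Support.UnitaryResolventMargin` (`exists_conjDiag_of_unitary`: unitary diagonalisation with unimodular eigenvalues, from the tree's
`MatrixLog.exists_isHermitian_exp_eq`).  NO Theses import.  Restates nothing; cites by name.

WHY.  The tree has the exponential chart's INJECTIVITY on the closed `π`-ball (`…ClosedBallSUN.expPtSU_injOn_pi`), its Haar identity
(CH)₁ there, the LOCAL logarithm near `1` (`ShellMeasureAxialReachSUN.exists_expPtSU_eq_of_dist1`, `N·dist1 U < 4`) and — file 18 — the
PROPERNESS of the windows of radius `S ≤ π` (`N ≥ 2`); it did not have the GLOBAL fact that the trace-free chart reaches every element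
of `SU(N)`.  The only point is the trace: `U = V·diag(e^{iθ})·V*` with `θ_j = arg λ_j ∈ (−π, π]` has `e^{iΣθ} = det U = 1`, but `Σθ`
itself is only a multiple of `2π`; subtracting `Σθ` from ONE angle keeps every `e^{iθ_j}` and makes the generator trace-free, at the
price `|θ'_j| ≤ (N+1)π`.

WHAT IS PROVED ([folklore] linear algebra; pub-balaban modules credited by name).
* §1 `cexp_arg_mul_I_of_norm_eq_one` (`‖z‖ = 1 ⇒ e^{i arg z} = z`), `neg_I_mul_ofReal_mul_I`.
* §2 `exists_herm_eq_conjDiag` — for a unitary frame `V` and real angles `θ` with `Σθ = 0` a chart point `v` with `H(v) = V·diag(θ)·V*`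
  (so `exp (genSU v) = V·diag(e^{iθ})·V*`, `‖v‖² = Σθ²` by the tree's `exp_genSU_eq_conjDiag` ∕ `norm_sq_eq_sum_sq`).
* §3 ★ `exists_expPtSU_eq` — `∀ U : SU(N), ∃ v, expPtSU v = U ∧ ‖v‖ ≤ (N+1)·√N·π`; ★ `expPtSU_surjective`;
  `expBallSU_eq_univ_of_le` ∕ `expWindowSU_eq_univ_of_le` (`S ≥ (N+1)·√N·π ⇒` the window about any centre is `SU(N)`);
  `iUnion_expBallSU` (the windows exhaust the group); `haar_expBallSU_eq_one_of_le` (Haar mass `1` — contrast file 18's `< 1` for `S ≤ π`).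
* §4 A2 `expPtSU_not_injOn_of_sqrt_two_mul_pi_le` — for `N ≥ 2` the chart is NOT one-to-one on the closed ball of radius `√2·π` (antipodal
  chart points `±v`, `H(v) = diag(π, −π, 0, …)`, share the exponential `diag(−1, −1, 1, …)`): the injectivity radius `π` of the tree's
  `…ClosedBallSUN.expPtSU_injOn_pi` cannot be pushed to `√2·π`.

HONEST FRAMING.  [folklore]; no located letter of any N21 road is touched; types nothing of Bałaban's; (M1) ∕ NE7c NOT PRINTED ∕ NOT proved;
**N21 NOT discharged**; K3⁷ NOT claimed; counts unmoved (typed 28∕28 · discharged 5∕27); never a count claim; one finite 𝕋⁴ at fixed ε —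
R4 would close only the conditional finite-𝕋⁴ rung `BalabanLadder.UV`, NOT the Yang–Mills mass gap (Clay); nothing about ℝ⁴ ∕ OS.  No decl
below carries a cite tag.
-/

set_option autoImplicit false

noncomputable section

open scoped BigOperators ENNReal
open MeasureTheory Set Function Metric Matrix
open Complex (I)

namespace Summit.QuantumFields.YangMills.Theorems.N21ExpChartSurjective

open Literature.MathematicalPhysics.QuantumFieldTheory.Balaban1983to89
open Literature.MathematicalPhysics.QuantumFieldTheory.Balaban1983to89.T4AdjointCovarianceUnitary (lieSU mem_lieSU_iff)
open Summit.QuantumFields.BalabanUV.T4Continuum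
open Summit.QuantumFields.BalabanUV.T4Continuum.ShellMeasureExpChartSUN
  (SUN ChartSU coordSU genSU expPtSU coe_expPtSU)
open Summit.QuantumFields.BalabanUV.T4Continuum.ShellMeasureVandermondeSUN
  (conjDiag conjDiag_one coe_mul_star_coe star_conjDiag smul_conjDiag trace_conjDiag)
open Summit.QuantumFields.BalabanUV.T4Continuum.ShellMeasureExpJacobianSUN (herm herm_smul exp_genSU_eq_conjDiag norm_sq_eq_sum_sq)
open Summit.QuantumFields.BalabanUV.T4Continuum.UnitaryResolventMargin (exists_conjDiag_of_unitary)
open Summit.QuantumFields.BalabanUV.T4Continuum.ShellMeasureScalingSUN (expBallSU expWindowSU measurableSet_expBallSU)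
open Summit.QuantumFields.YangMills.Theorems.N21ExpWindowHaarMassLtOne (det_conjDiag haar_expBallSU_lt_one)

variable {N : ℕ}

/-! ## §1 Unimodular numbers and their angles -/

/-- a unimodular complex number is `e^{i·arg}`. [folklore] -/
theorem cexp_arg_mul_I_of_norm_eq_one {z : ℂ} (hz : ‖z‖ = 1) : Complex.exp (Complex.arg z * I) = z := by
  have hz0 : z ≠ 0 := fun h => by simp [h] at hz
  have hlog : Complex.log z = Complex.arg z * I :=
    Complex.ext (by simp [Complex.log_re, hz]) (by simp [Complex.log_im])
  rw [← hlog, Complex.exp_log hz0]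

/-- `−i·(t·i) = t`. [folklore] -/
theorem neg_I_mul_ofReal_mul_I (t : ℝ) : -I * ((t : ℂ) * I) = t := by
  rw [neg_mul, mul_left_comm, Complex.I_mul_I, mul_neg_one, neg_neg]

/-! ## §2 Chart points with prescribed eigen-frame and angles -/

/-- **A CHART POINT WITH PRESCRIBED FRAME AND ANGLES**: for a unitary frame `V` and real angles `θ` with `Σ θ = 0` there is a chart
point `v` whose Hermitian generator is `H(v) = V·diag(θ)·V*` (the matrix `V·diag(iθ)·V*` is skew-Hermitian and trace-free, i.e. in
`𝔰𝔲(N)`, and `coordSU` is onto `𝔰𝔲(N)`); then `exp (genSU v) = V·diag(e^{iθ})·V*` and `‖v‖² = Σ θ²` by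
`ShellMeasureExpJacobianSUN.exp_genSU_eq_conjDiag` ∕ `norm_sq_eq_sum_sq`. [folklore] -/
theorem exists_herm_eq_conjDiag (V : Matrix.unitaryGroup (Fin N) ℂ) (θ : Fin N → ℝ) (hθ : ∑ j, θ j = 0) :
    ∃ v : ChartSU N, herm v = conjDiag V fun j => (θ j : ℂ) := by
  set X : Matrix (Fin N) (Fin N) ℂ := conjDiag V fun j => (θ j : ℂ) * I with hXdef
  have hXstar : star X = -X := by
    rw [hXdef, star_conjDiag, ← neg_one_smul ℂ (conjDiag V fun j => (θ j : ℂ) * I), smul_conjDiag]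
    congr 1
    funext j
    simp only [Pi.star_apply, Pi.smul_apply, smul_eq_mul, star_mul', Complex.star_def, Complex.conj_ofReal,
      Complex.conj_I]
    ring
  have hXtr : X.trace = 0 := by
    rw [hXdef, trace_conjDiag, ← Finset.sum_mul, ← Complex.ofReal_sum, hθ, Complex.ofReal_zero, zero_mul]
  have hX : X ∈ lieSU (Fin N) := mem_lieSU_iff.mpr ⟨hXstar, hXtr⟩
  refine ⟨(coordSU (N := N)).symm ⟨X, hX⟩, ?_⟩
  have hgen : genSU ((coordSU (N := N)).symm ⟨X, hX⟩) = X := by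
    show ((coordSU ((coordSU (N := N)).symm ⟨X, hX⟩) : lieSU (Fin N)) : Matrix (Fin N) (Fin N) ℂ) = X
    rw [LinearIsometryEquiv.apply_symm_apply]
  show (-I) • genSU ((coordSU (N := N)).symm ⟨X, hX⟩) = conjDiag V fun j => (θ j : ℂ)
  rw [hgen, hXdef, smul_conjDiag]
  congr 1
  funext j
  rw [Pi.smul_apply, smul_eq_mul, neg_I_mul_ofReal_mul_I]

/-! ## §3 The exponential chart of `SU(N)` is onto, with a Hilbert–Schmidt norm bound -/

variable [NeZero N]

/-- ★ **EVERY ELEMENT OF `SU(N)` IS A CHART POINT OF HILBERT–SCHMIDT NORM `≤ (N+1)·√N·π`.**  Diagonalise `U = V·diag(λ)·V*`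
(`UnitaryResolventMargin.exists_conjDiag_of_unitary`), take the angles `θ_j = arg λ_j ∈ (−π, π]`; `det U = 1` gives
`e^{iΣθ} = 1`, so subtracting `Σθ` from ONE angle yields a trace-free skew-Hermitian generator `X = V·diag(iθ')·V* ∈ 𝔰𝔲(N)` with
`exp X = U` and `Σ θ'² ≤ N·((N+1)π)²`. [folklore] -/
theorem exists_expPtSU_eq (U : SUN N) :
    ∃ v : ChartSU N, expPtSU v = U ∧ ‖v‖ ≤ ((N : ℝ) + 1) * Real.sqrt N * Real.pi := by
  obtain ⟨V, lam, hlam, hW0⟩ := exists_conjDiag_of_unitary (Matrix.mem_specialUnitaryGroup_iff.mp U.2).1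
  -- `UnitaryCayley.conjDiag` and `ShellMeasureVandermondeSUN.conjDiag` are the same expression `V·diag·V*`
  have hW : (U : Matrix (Fin N) (Fin N) ℂ) = conjDiag V lam := hW0
  -- the angles
  set θ : Fin N → ℝ := fun j => Complex.arg (lam j) with hθdef
  have hθlam : ∀ j, Complex.exp (θ j * I) = lam j := fun j => cexp_arg_mul_I_of_norm_eq_one (hlam j)
  have hθπ : ∀ j, |θ j| ≤ Real.pi := fun j => Complex.abs_arg_le_pi _
  -- det U = 1 ⇒ e^{iΣθ} = 1
  have hdet : (U : Matrix (Fin N) (Fin N) ℂ).det = 1 := (Matrix.mem_specialUnitaryGroup_iff.mp U.2).2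
  have hsum1 : Complex.exp (((∑ j, θ j : ℝ) : ℂ) * I) = 1 := by
    rw [hW, det_conjDiag] at hdet
    rw [Complex.ofReal_sum, Finset.sum_mul, Complex.exp_sum]
    calc ∏ j, Complex.exp ((θ j : ℂ) * I) = ∏ j, lam j := Finset.prod_congr rfl fun j _ => hθlam j
      _ = 1 := hdet
  -- the corrected angles
  let j₀ : Fin N := ⟨0, Nat.pos_of_ne_zero (NeZero.ne N)⟩
  set θ' : Fin N → ℝ := fun j => θ j - if j = j₀ then ∑ i, θ i else 0 with hθ'def
  have hsum0 : ∑ j, θ' j = 0 := by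
    simp only [hθ'def, Finset.sum_sub_distrib, Finset.sum_ite_eq', Finset.mem_univ, if_true, sub_self]
  have hθ'lam : ∀ j, Complex.exp (θ' j * I) = lam j := by
    intro j
    by_cases hj : j = j₀
    · have h1 : θ' j = θ j - ∑ i, θ i := by simp only [hθ'def, hj, if_true]
      rw [h1, Complex.ofReal_sub, sub_mul, Complex.exp_sub, hsum1, div_one, hθlam]
    · have h1 : θ' j = θ j := by simp only [hθ'def, hj, if_false, sub_zero]
      rw [h1, hθlam]
  have hsabs : |∑ i, θ i| ≤ N * Real.pi := by
    calc |∑ i, θ i| ≤ ∑ i, |θ i| := Finset.abs_sum_le_sum_abs _ _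
      _ ≤ ∑ _i : Fin N, Real.pi := Finset.sum_le_sum fun i _ => hθπ i
      _ = N * Real.pi := by simp
  have hθ'bd : ∀ j, |θ' j| ≤ ((N : ℝ) + 1) * Real.pi := by
    intro j
    by_cases hj : j = j₀
    · have h1 : θ' j = θ j - ∑ i, θ i := by simp only [hθ'def, hj, if_true]
      rw [h1]
      calc |θ j - ∑ i, θ i| ≤ |θ j| + |∑ i, θ i| := abs_sub _ _
        _ ≤ Real.pi + N * Real.pi := add_le_add (hθπ j) hsabs
        _ = ((N : ℝ) + 1) * Real.pi := by ring
    · have h1 : θ' j = θ j := by simp only [hθ'def, hj, if_false, sub_zero]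
      rw [h1]
      calc |θ j| ≤ Real.pi := hθπ j
        _ = (0 + 1) * Real.pi := by ring
        _ ≤ ((N : ℝ) + 1) * Real.pi := by gcongr; exact Nat.cast_nonneg N
  -- the chart point with frame `V` and angles `θ'`
  obtain ⟨v, hherm⟩ := exists_herm_eq_conjDiag V θ' hsum0
  refine ⟨v, ?_, ?_⟩
  · apply Subtype.ext
    rw [coe_expPtSU, exp_genSU_eq_conjDiag hherm, hW]
    congr 1
    funext j
    exact hθ'lam j
  · have hsq : ‖v‖ ^ 2 = ∑ j, θ' j ^ 2 := norm_sq_eq_sum_sq hherm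
    have hle : ∑ j, θ' j ^ 2 ≤ ∑ _j : Fin N, (((N : ℝ) + 1) * Real.pi) ^ 2 :=
      Finset.sum_le_sum fun j _ => by
        rw [← sq_abs (θ' j)]
        exact pow_le_pow_left₀ (abs_nonneg _) (hθ'bd j) 2
    have hN : ∑ _j : Fin N, (((N : ℝ) + 1) * Real.pi) ^ 2 = N * (((N : ℝ) + 1) * Real.pi) ^ 2 := by simp
    have htarget : (((N : ℝ) + 1) * Real.sqrt N * Real.pi) ^ 2 = N * (((N : ℝ) + 1) * Real.pi) ^ 2 := by
      rw [mul_pow, mul_pow, Real.sq_sqrt (Nat.cast_nonneg N)]; ring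
    have h0 : 0 ≤ ((N : ℝ) + 1) * Real.sqrt N * Real.pi := by positivity
    refine (pow_le_pow_iff_left₀ (norm_nonneg v) h0 two_ne_zero).mp ?_
    rw [hsq, htarget]
    exact hle.trans hN.le

/-- ★ **THE EXPONENTIAL CHART OF `SU(N)` IS ONTO** (`exp : 𝔰𝔲(N) → SU(N)` is surjective). [folklore] -/
theorem expPtSU_surjective : Function.Surjective (expPtSU (N := N)) := fun U =>
  (exists_expPtSU_eq U).imp fun _ h => h.1

/-- **LARGE WINDOWS ARE THE WHOLE GROUP**: `expBallSU S = SU(N)` once `S ≥ (N+1)·√N·π`. [folklore] -/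
theorem expBallSU_eq_univ_of_le {S : ℝ} (hS : ((N : ℝ) + 1) * Real.sqrt N * Real.pi ≤ S) :
    expBallSU (N := N) S = univ :=
  eq_univ_of_forall fun U => by
    obtain ⟨v, hv, hvn⟩ := exists_expPtSU_eq U
    exact ⟨v, mem_closedBall_zero_iff.mpr (hvn.trans hS), hv⟩

/-- … and so is every window `g · expBallSU S` about any centre. [folklore] -/
theorem expWindowSU_eq_univ_of_le (g : SUN N) {S : ℝ} (hS : ((N : ℝ) + 1) * Real.sqrt N * Real.pi ≤ S) :
    expWindowSU g S = univ := by
  rw [expWindowSU, expBallSU_eq_univ_of_le hS, image_univ]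
  exact (mul_left_surjective g).range_eq

/-- THE WINDOWS EXHAUST THE GROUP: `⋃_S expBallSU S = SU(N)`. [folklore] -/
theorem iUnion_expBallSU : (⋃ S : ℝ, expBallSU (N := N) S) = univ :=
  eq_univ_of_forall fun U => mem_iUnion.mpr ⟨_, (expBallSU_eq_univ_of_le (N := N) le_rfl).symm ▸ mem_univ U⟩

/-- **HAAR MASS ONE FOR LARGE WINDOWS** (contrast: `< 1` for `S ≤ π`, `N ≥ 2` — file 18): for `S ≥ (N+1)·√N·π` the window has
Haar mass `1`. [folklore] -/
theorem haar_expBallSU_eq_one_of_le {S : ℝ} (hS : ((N : ℝ) + 1) * Real.sqrt N * Real.pi ≤ S) :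
    (HaarData.haar : Measure (SUN N)) (expBallSU S) = 1 := by
  haveI : IsProbabilityMeasure (HaarData.haar : Measure (SUN N)) := HaarData.isProb
  rw [expBallSU_eq_univ_of_le hS, measure_univ]


/-! ## §4 A2: onto, but NOT one-to-one beyond radius `√2·π` — the injectivity radius `π` of the tree cannot be pushed to `√2·π` -/

omit [NeZero N] in
/-- A2 WITNESS: for `N ≥ 2` the chart is NOT injective on the closed ball of radius `√2·π` (or any larger one): the antipodal chart
points `±v` with `H(v) = diag(π, −π, 0, …, 0)` have `‖±v‖ = √2·π` and the SAME exponential `diag(−1, −1, 1, …, 1)`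
(`e^{iπ} = e^{−iπ}`).  Contrast the tree's `ShellMeasureExpHaarClosedBallSUN.expPtSU_injOn_pi` (one-to-one on the closed `π`-ball). [folklore] -/
theorem expPtSU_not_injOn_of_sqrt_two_mul_pi_le (hN : 2 ≤ N) {S : ℝ} (hS : Real.sqrt 2 * Real.pi ≤ S) :
    ¬ InjOn (expPtSU (N := N)) (closedBall 0 S) := by
  -- the angles (π, −π, 0, …, 0)
  let i₀ : Fin N := ⟨0, by omega⟩
  let i₁ : Fin N := ⟨1, by omega⟩
  have hne : i₁ ≠ i₀ := fun h => by
    have := congrArg Fin.val h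
    simp [i₀, i₁] at this
  let θ : Fin N → ℝ := fun j => if j = i₀ then Real.pi else if j = i₁ then -Real.pi else 0
  have hθ₀ : θ i₀ = Real.pi := by simp [θ]
  have hθ₁ : θ i₁ = -Real.pi := by simp [θ, hne]
  have hθr : ∀ j, j ≠ i₀ → j ≠ i₁ → θ j = 0 := fun j h0 h1 => by simp [θ, h0, h1]
  have hsum : ∑ j, θ j = 0 := by
    rw [← Finset.add_sum_erase _ _ (Finset.mem_univ i₀),
      ← Finset.add_sum_erase _ _ (Finset.mem_erase.mpr ⟨hne, Finset.mem_univ i₁⟩),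
      Finset.sum_eq_zero (fun j hj => ?_), hθ₀, hθ₁]
    · ring
    · obtain ⟨hj1, hj⟩ := Finset.mem_erase.mp hj
      obtain ⟨hj0, _⟩ := Finset.mem_erase.mp hj
      exact hθr j hj0 hj1
  have hsq : ∑ j, θ j ^ 2 = 2 * Real.pi ^ 2 := by
    rw [← Finset.add_sum_erase _ _ (Finset.mem_univ i₀),
      ← Finset.add_sum_erase _ _ (Finset.mem_erase.mpr ⟨hne, Finset.mem_univ i₁⟩),
      Finset.sum_eq_zero (fun j hj => ?_), hθ₀, hθ₁]
    · ring
    · obtain ⟨hj1, hj⟩ := Finset.mem_erase.mp hj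
      obtain ⟨hj0, _⟩ := Finset.mem_erase.mp hj
      rw [hθr j hj0 hj1]; ring
  -- every angle is `0` or `±π`, so `e^{iθ_j} = e^{−iθ_j}`
  have hcos : ∀ j, Complex.exp ((θ j : ℂ) * I) = Complex.exp (((-θ j : ℝ) : ℂ) * I) := by
    intro j
    have key : ∀ t : ℝ, (t = Real.pi ∨ t = -Real.pi ∨ t = 0) → Complex.exp ((t : ℂ) * I) = Complex.exp (((-t : ℝ) : ℂ) * I) := by
      rintro t (rfl | rfl | rfl)
      · rw [Complex.exp_pi_mul_I, Complex.ofReal_neg, neg_mul, Complex.exp_neg, Complex.exp_pi_mul_I]; norm_num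
      · rw [Complex.ofReal_neg, neg_mul, Complex.exp_neg, Complex.exp_pi_mul_I, neg_neg, Complex.exp_pi_mul_I]; norm_num
      · simp
    refine key (θ j) ?_
    by_cases h0 : j = i₀
    · exact Or.inl (by rw [h0, hθ₀])
    · by_cases h1 : j = i₁
      · exact Or.inr (Or.inl (by rw [h1, hθ₁]))
      · exact Or.inr (Or.inr (hθr j h0 h1))
  -- the two chart points
  haveI : NeZero N := ⟨by omega⟩
  obtain ⟨v, hv⟩ := exists_herm_eq_conjDiag (1 : Matrix.unitaryGroup (Fin N) ℂ) θ hsum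
  have hvneg : herm (-v) = conjDiag 1 fun j => ((-θ j : ℝ) : ℂ) := by
    rw [← neg_one_smul ℝ v, herm_smul, hv, smul_conjDiag]
    congr 1
    funext j
    simp
  have hnorm : ‖v‖ = Real.sqrt 2 * Real.pi := by
    have h2 : ‖v‖ ^ 2 = (Real.sqrt 2 * Real.pi) ^ 2 := by
      rw [norm_sq_eq_sum_sq hv, hsq, mul_pow, Real.sq_sqrt (by norm_num : (0 : ℝ) ≤ 2)]
    have h0 : 0 ≤ Real.sqrt 2 * Real.pi := by positivity
    nlinarith [norm_nonneg v, h0, sq_nonneg (‖v‖ - Real.sqrt 2 * Real.pi), sq_nonneg (‖v‖ + Real.sqrt 2 * Real.pi)]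
  have hv0 : v ≠ 0 := by
    intro h
    rw [h, norm_zero] at hnorm
    have : 0 < Real.sqrt 2 * Real.pi := by positivity
    linarith
  have hmem : v ∈ closedBall (0 : ChartSU N) S := mem_closedBall_zero_iff.mpr (hnorm ▸ hS)
  have hmem' : -v ∈ closedBall (0 : ChartSU N) S := by rw [mem_closedBall_zero_iff, norm_neg]; exact hnorm ▸ hS
  have hexp : expPtSU v = expPtSU (-v) := by
    apply Subtype.ext
    rw [coe_expPtSU, coe_expPtSU, exp_genSU_eq_conjDiag hv, exp_genSU_eq_conjDiag hvneg]
    congr 1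
    funext j
    exact hcos j
  intro hinj
  have := hinj hmem hmem' hexp
  exact hv0 (by
    have h2 : (2 : ℝ) • v = 0 := by rw [two_smul]; nth_rewrite 2 [this]; exact add_neg_cancel v
    exact (smul_eq_zero.mp h2).resolve_left two_ne_zero)

end Summit.QuantumFields.YangMills.Theorems.N21ExpChartSurjective

end
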